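import Literature.NumberTheory.GaloisCohomology.Howard2004.TowerMorphism
import Literature.NumberTheory.GaloisCohomology.Howard2004.KolyvaginSystemPushforward
import Literature.NumberTheory.GaloisCohomology.Howard2004.KolyvaginSystemScalars
import HarnessLib

/-!
# Howard 2004, Remark 1.2.4: the pushforward of a Kolyvagin system along a morphism of tower settings

Howard [Rem. 1.2.4, arXiv:1202.6340 Rem. 2.2.4, p. 7 L13–27; proof of Thm. 2.2.10 = arXiv
Thm. 3.2.10, p. 17 L78–81]: «Remark (functorality) and Lemma (local comparison) yield a map
`KS(𝐓, F_Λ, 𝓛_s(𝐓)) → KS(T_𝔭, F_𝔭, 𝓛_s(T_𝔭))`».  Along a morphism of tower settings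
`h : CoeffTowerSetting.Hom φ S S′` (`Howard2004/TowerMorphism.lean`: level maps `f_k`, maps of the
Kolyvagin quotients `fq_{k,n}`, `𝓛′ ⊆ 𝓛`, `F ≤ F′` after the change, `φ^{fs}` natural) this file
DISCHARGES the hypotheses of the level-wise core `LevelData.mapFamily_mem_KS`
(`Howard2004/KolyvaginSystemPushforward.lean`) and assembles

* `CoeffTowerSetting.Hom.pushforward h hprimes κ : S′.KolyvaginSystem` for `κ : S.KolyvaginSystem`,
  with `(h.pushforward hprimes κ).one k = H¹(f_k) (κ.one k)` (`pushforward_one`).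

Generic lemmas on the way (all for the tree's presentations `IsQuotientBy` / `LevelData`):
`localization_cohomologyMap_one` (localisation commutes with `H¹` of an equivariant map),
`cohomologyMap_one_comp_eq` (triangles on `H¹`), `cohomologyMap_mem_transverseCondition`
(Howard-transverse classes are functorial in the module), `LevelData.fq_transition` /
`LevelData.cohomologyMap_redH1` (the maps of the Kolyvagin quotients commute with `T/I_n → T/I_{nℓ}`),
(the finiteness of `loc_ℓ red(κ_n)` for `κ_n ∈ H¹_{F(n)}`, `ℓ ∈ 𝓛 ∖ n` is the tree's
`LevelData.localization_redH1_mem_unramifiedSubgroup`, `Howard2004/KolyvaginSystemScalars.lean`), `LevelData.cohomologyMap_mem_selmerAt` (`H¹(fq)` carries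
`H¹_{F(n)}` into `H¹_{F′(n)}` when `F ≤ F′` after the change).
Definitions with bodies and theorems; no named fact, no instance, no `sorry`.  The hypothesis
`hprimes : ∀ k, (S′.t k).primes ⊆ (S.t k).primes` is the level-wise form of `𝓛′ ⊆ 𝓛` (for DVR
settings it is `primes_eq` + `Hom.primes_subset`, `hprimes_of_primes_eq`).  BSD is not proved by any
of this.

References: B. Howard, *The Heegner point Kolyvagin system*, Compositio Math. 140 (2004),
Rem. 1.2.4, Def. 1.2.2–1.2.3, proof of Thm. 2.2.10 (arXiv:1202.6340, p. 6 L101 – p. 7 L27, p. 17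
L78–81); J.-P. Serre, *Galois Cohomology* (1997), I §2.2–2.4.
-/

set_option autoImplicit false

noncomputable section

open Function NumberField IsDedekindDomain Field CategoryTheory
open scoped NumberField ContRepresentation Classical TensorProduct

namespace Literature.NumberTheory.GaloisCohomology.Howard2004

open Literature.NumberTheory.GaloisRepresentations
open Literature.NumberTheory.GaloisRepresentations.DiscreteGaloisModule

/-! ## Generic squares and triangles on `H¹` -/

section Generic

variable {K : Type} [Field K]
  {M₁ : Type} [AddCommGroup M₁] [TopologicalSpace M₁] [DiscreteTopology M₁]
  {M₂ : Type} [AddCommGroup M₂] [TopologicalSpace M₂] [DiscreteTopology M₂]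
  {M₃ : Type} [AddCommGroup M₃] [TopologicalSpace M₃] [DiscreteTopology M₃]

/-- **Triangle on `H¹`**: if `b ∘ a = d` pointwise (equivariant additive maps of discrete
`Γ_K`-modules), then `H¹(b) ∘ H¹(a) = H¹(d)`. [cite: SerreGaloisCohomology1997, I §2.2] -/
theorem cohomologyMap_one_comp_eq (τ₁ : DiscreteGaloisModule K M₁) (τ₂ : DiscreteGaloisModule K M₂)
    (τ₃ : DiscreteGaloisModule K M₃)
    (a : M₁ →+ M₂) (ha : ∀ (g : absoluteGaloisGroup K) (x : M₁), a (τ₁ g x) = τ₂ g (a x))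
    (b : M₂ →+ M₃) (hb : ∀ (g : absoluteGaloisGroup K) (x : M₂), b (τ₂ g x) = τ₃ g (b x))
    (d : M₁ →+ M₃) (hd : ∀ (g : absoluteGaloisGroup K) (x : M₁), d (τ₁ g x) = τ₃ g (d x))
    (h : ∀ x, b (a x) = d x) (x : galoisCohomology τ₁ 1) :
    ContinuousRep.cohomologyMap τ₂ τ₃ b continuous_of_discreteTopology hb 1
        (ContinuousRep.cohomologyMap τ₁ τ₂ a continuous_of_discreteTopology ha 1 x) =
      ContinuousRep.cohomologyMap τ₁ τ₃ d continuous_of_discreteTopology hd 1 x := by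
  obtain ⟨z, rfl⟩ := oneCocycleClass_surjective τ₁.toTopRep x
  rw [cohomologyMap_one_oneCocycleClass, cohomologyMap_one_oneCocycleClass,
    cohomologyMap_one_oneCocycleClass]
  congr 1
  refine Subtype.ext (ContinuousMap.ext fun g => ?_)
  exact h _

variable [NumberField K]

/-- **Localisation commutes with `H¹` of an equivariant map**: `loc_v ∘ H¹(K, π) = H¹(K_v, π) ∘ loc_v`.
[cite: SerreGaloisCohomology1997, I §2.4 (restriction is natural in the module)] -/
theorem localization_cohomologyMap_one (τ₁ : DiscreteGaloisModule K M₁) (τ₂ : DiscreteGaloisModule K M₂)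
    (π : M₁ →+ M₂) (hπ : ∀ (g : absoluteGaloisGroup K) (x : M₁), π (τ₁ g x) = τ₂ g (π x))
    (v : Place K) (x : galoisCohomology τ₁ 1) :
    galoisCohomology.localization τ₂ v 1
        (ContinuousRep.cohomologyMap τ₁ τ₂ π continuous_of_discreteTopology hπ 1 x) =
      ContinuousRep.cohomologyMap (τ₁.toLocal v) (τ₂.toLocal v) π continuous_of_discreteTopology
        (fun _ y => hπ _ y) 1 (galoisCohomology.localization τ₁ v 1 x) := by
  obtain ⟨z, rfl⟩ := oneCocycleClass_surjective τ₁.toTopRep x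
  have e1 : ContinuousRep.cohomologyMap τ₁ τ₂ π continuous_of_discreteTopology hπ 1
      (oneCocycleClass _ z) = oneCocycleClass _ _ := map_oneCocycleClass _ _ _ z
  have e2 : galoisCohomology.localization τ₁ v 1 (oneCocycleClass _ z) = oneCocycleClass _ _ :=
    map_oneCocycleClass _ _ _ z
  rw [e1, e2]
  refine (map_oneCocycleClass _ _ _ _).trans ?_
  symm
  refine (map_oneCocycleClass _ _ _ _).trans ?_
  congr 1

/-- **Howard-transverse classes are functorial in the module**: `H¹_tr(K_ℓ, ·) = ker (res to Γ_L)`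
with `L` depending only on `ℓ` and `jbar`, so `H¹(K_ℓ, π)` carries `H¹_tr(K_ℓ, M₁)` into
`H¹_tr(K_ℓ, M₂)` (for the LOCAL modules at `ℓ`).
[cite: Howard2004HeegnerKolyvagin, §1.1 transverse condition and Def. 1.2.2 (arXiv p. 5 L52–56, p. 6 L101–120)] -/
theorem cohomologyMap_mem_transverseCondition {p : ℕ} [Fact p.Prime] (τ₁ : DiscreteGaloisModule K M₁)
    (τ₂ : DiscreteGaloisModule K M₂) (π : M₁ →+ M₂)
    (hπ : ∀ (g : absoluteGaloisGroup K) (x : M₁), π (τ₁ g x) = τ₂ g (π x))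
    (ℓ : ℕ) (jbar : AlgebraicClosure K →+* ℂ) (v : HeightOneSpectrum (𝓞 K))
    {c : galoisCohomology (GaloisRep.toLocal v τ₁) 1} (hc : c ∈ transverseCondition p τ₁ ℓ jbar v) :
    ContinuousRep.cohomologyMap (τ₁.toLocal (Sum.inr v)) (τ₂.toLocal (Sum.inr v)) π
        continuous_of_discreteTopology (fun _ y => hπ _ y) 1 c ∈ transverseCondition p τ₂ ℓ jbar v := by
  obtain ⟨z, rfl⟩ := oneCocycleClass_surjective _ c
  have hc' : resSubgroup (DiscreteGaloisModule.toTopRep (GaloisRep.toLocal v τ₁))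
      (transverseFixer p ℓ jbar v) 1 (oneCocycleClass _ z) = 0 := hc
  have hc'' := (map_oneCocycleClass _ _ _ _).symm.trans hc'
  rw [oneCocycleClass_eq_zero_iff] at hc''
  obtain ⟨y, hy⟩ := hc''
  change resSubgroup (DiscreteGaloisModule.toTopRep (GaloisRep.toLocal v τ₂))
      (transverseFixer p ℓ jbar v) 1
      (ContinuousRep.cohomologyMap (τ₁.toLocal (Sum.inr v)) (τ₂.toLocal (Sum.inr v)) π
        continuous_of_discreteTopology (fun _ y => hπ _ y) 1 (oneCocycleClass _ z)) = 0
  have e1 : ContinuousRep.cohomologyMap (τ₁.toLocal (Sum.inr v)) (τ₂.toLocal (Sum.inr v)) π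
      continuous_of_discreteTopology (fun _ y => hπ _ y) 1 (oneCocycleClass _ z) = oneCocycleClass _ _ :=
    map_oneCocycleClass _ _ _ z
  rw [e1]
  refine (map_oneCocycleClass _ _ _ _).trans ?_
  rw [oneCocycleClass_eq_zero_iff]
  refine ⟨π y, fun σ => ?_⟩
  have hσ := hy σ
  change π (z.1 _) = _
  change z.1 _ = _ at hσ
  rw [hσ, map_sub]
  exact congrArg (· - π y) (hπ _ y)

end Generic

/-! ## Level data: the maps of the Kolyvagin quotients versus reduction, localisation, `H¹_{F(n)}` -/

namespace LevelData

variable {K : Type} [Field K] [NumberField K] {p : ℕ} [Fact p.Prime]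
  {M : Type} [AddCommGroup M] [TopologicalSpace M] [DiscreteTopology M]
  {R : Type} [CommRing R] [Module R M] {ρ : DiscreteGaloisModule K M} {t : SelmerTriple p ρ}
  {N : Finset (HeightOneSpectrum (𝓞 K)) → Type} [∀ n, AddCommGroup (N n)]
  [∀ n, TopologicalSpace (N n)] [∀ n, DiscreteTopology (N n)] [∀ n, Module R (N n)]
  {M' : Type} [AddCommGroup M'] [TopologicalSpace M'] [DiscreteTopology M']
  {R' : Type} [CommRing R'] [Module R' M'] {ρ' : DiscreteGaloisModule K M'} {t' : SelmerTriple p ρ'}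
  {N' : Finset (HeightOneSpectrum (𝓞 K)) → Type} [∀ n, AddCommGroup (N' n)]
  [∀ n, TopologicalSpace (N' n)] [∀ n, DiscreteTopology (N' n)] [∀ n, Module R' (N' n)]

variable (D : LevelData R ρ t N) (D' : LevelData R' ρ' t' N')
  (f : M →+ M') (hf : ∀ (g : absoluteGaloisGroup K) (x : M), f (ρ g x) = ρ' g (f x))
  (fq : ∀ n, N n →+ N' n)
  (hfq : ∀ n (g : absoluteGaloisGroup K) (y : N n), fq n (D.ρq n g y) = D'.ρq n g (fq n y))
  (hcomp : ∀ n (x : M), fq n (D.π n x) = D'.π n (f x))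

omit [Fact p.Prime] in
include hcomp in
/-- **The maps of the Kolyvagin quotients commute with `T/I_nT → T/I_{n'}T`** (pointwise): from
`fq ∘ π_n = π′_n ∘ f` and the surjectivity of `π_n`.
[cite: Howard2004HeegnerKolyvagin, Def. 1.1.3 and Rem. 1.2.4 (arXiv p. 5 L93–99, p. 7 L13–27)] -/
theorem fq_transition {n n' : Finset (HeightOneSpectrum (𝓞 K))} (hI : levelIdeal (R := R) ρ n ≤ levelIdeal ρ n')
    (hI' : levelIdeal (R := R') ρ' n ≤ levelIdeal ρ' n') (y : N n) :
    fq n' ((D.isQuotientBy n).transition (D.isQuotientBy n') hI y) =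
      (D'.isQuotientBy n).transition (D'.isQuotientBy n') hI' (fq n y) := by
  obtain ⟨x, rfl⟩ := (D.isQuotientBy n).surjective y
  rw [IsQuotientBy.transition_apply, hcomp, hcomp, IsQuotientBy.transition_apply]

omit [Fact p.Prime] in
include hcomp in
/-- **`H¹(fq)` commutes with the reductions `red : H¹(K, T/I_nT) → H¹(K, T/I_{nℓ}T)`.**
[cite: Howard2004HeegnerKolyvagin, Def. 1.2.3 and Rem. 1.2.4 (arXiv p. 6 L126 – p. 7 L27)] -/
theorem cohomologyMap_redH1 (n : Finset (HeightOneSpectrum (𝓞 K))) (v : HeightOneSpectrum (𝓞 K))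
    (c : galoisCohomology (D.ρq n) 1) :
    ContinuousRep.cohomologyMap (D.ρq (insert v n)) (D'.ρq (insert v n)) (fq (insert v n))
        continuous_of_discreteTopology (hfq (insert v n)) 1 (D.redH1 n v c) =
      D'.redH1 n v (ContinuousRep.cohomologyMap (D.ρq n) (D'.ρq n) (fq n)
        continuous_of_discreteTopology (hfq n) 1 c) :=
  cohomologyMap_one_comm_sq (D.ρq n) (D.ρq (insert v n)) (D'.ρq n) (D'.ρq (insert v n))
    ((D.isQuotientBy n).transition (D.isQuotientBy (insert v n))
      (levelIdeal_mono ρ (Finset.subset_insert v n))).toAddMonoidHom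
    ((D.isQuotientBy n).transition_equivariant (D.isQuotientBy (insert v n))
      (levelIdeal_mono ρ (Finset.subset_insert v n)))
    (fq (insert v n)) (hfq (insert v n)) (fq n) (hfq n)
    ((D'.isQuotientBy n).transition (D'.isQuotientBy (insert v n))
      (levelIdeal_mono ρ' (Finset.subset_insert v n))).toAddMonoidHom
    ((D'.isQuotientBy n).transition_equivariant (D'.isQuotientBy (insert v n))
      (levelIdeal_mono ρ' (Finset.subset_insert v n)))
    (fun y => fq_transition D D' f fq hcomp (levelIdeal_mono ρ (Finset.subset_insert v n))
      (levelIdeal_mono ρ' (Finset.subset_insert v n)) y) c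

include hf hcomp in
/-- **`H¹(fq)` carries `H¹_{F(n)}(K, T/I_nT)` into `H¹_{F′(n)}(K, T′/I_nT′)`** when, after the change,
`F ≤ F′` at every place (`hcond`; Howard: «`F ⊗_R R′` is the image … if `H¹_F ⊂ H¹_{F′}` at every
place there is a map»): at `v ∉ n` by `hcond`, at `λ ∈ n` because the transverse condition is
functorial in the module, both through the square `H¹(fq) ∘ H¹(π_n) = H¹(π′_n) ∘ H¹(f)`.
[cite: Howard2004HeegnerKolyvagin, Rem. 1.2.4 (ii)+(iii) and Def. 1.2.2–1.2.3 (arXiv p. 6 L101 – p. 7 L27)] -/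
theorem cohomologyMap_mem_selmerAt (jbar : AlgebraicClosure K →+* ℂ)
    (hcond : ∀ v : Place K, ((t.cond v).map
      (ContinuousRep.cohomologyMap (ρ.toLocal v) (ρ'.toLocal v) f continuous_of_discreteTopology
        (fun _ x => hf _ x) 1)) ≤ t'.cond v)
    {n : Finset (HeightOneSpectrum (𝓞 K))} {c : galoisCohomology (D.ρq n) 1}
    (hc : c ∈ D.selmerAt jbar n) :
    ContinuousRep.cohomologyMap (D.ρq n) (D'.ρq n) (fq n) continuous_of_discreteTopology (hfq n) 1 c ∈
      D'.selmerAt jbar n := by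
  refine (D'.mem_selmerAt_iff jbar n _).mpr fun w => ?_
  obtain ⟨u, hu, hu'⟩ := (D.mem_selmerAt_iff jbar n c).mp hc w
  rw [localization_cohomologyMap_one, ← hu']
  change ContinuousRep.cohomologyMap _ _ _ _ _ 1
      (ContinuousRep.cohomologyMap (ρ.toLocal w) ((D.ρq n).toLocal w) (D.π n).toAddMonoidHom
        continuous_of_discreteTopology (fun _ m => (D.isQuotientBy n).equivariant _ m) 1 u) ∈ _
  rw [cohomologyMap_one_comm_sq (ρ.toLocal w) ((D.ρq n).toLocal w) (ρ'.toLocal w) ((D'.ρq n).toLocal w)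
    (D.π n).toAddMonoidHom (fun _ m => (D.isQuotientBy n).equivariant _ m) (fq n) (fun _ y => hfq n _ y)
    f (fun _ x => hf _ x) (D'.π n).toAddMonoidHom (fun _ m => (D'.isQuotientBy n).equivariant _ m)
    (fun x => hcomp n x) u]
  refine ⟨_, ?_, rfl⟩
  -- `H¹(K_w, f) u ∈ F′(n)_w`
  rcases w with w | v
  · exact hcond _ ⟨u, hu, rfl⟩
  · by_cases hv : v ∈ n
    · rw [SelmerTriple.atLevel_cond_inr_of_mem t jbar hv] at hu
      rw [SelmerTriple.atLevel_cond_inr_of_mem t' jbar hv]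
      exact cohomologyMap_mem_transverseCondition ρ ρ' f hf _ jbar v hu
    · rw [SelmerTriple.atLevel_cond_inr_of_not_mem t jbar hv] at hu
      rw [SelmerTriple.atLevel_cond_inr_of_not_mem t' jbar hv]
      exact hcond _ ⟨u, hu, rfl⟩

end LevelData

/-! ## The pushforward `KS(T, F, 𝓛) → KS(T′, F′, 𝓛′)` along a morphism of tower settings -/

namespace CoeffTowerSetting.Hom

variable {p : ℕ} [Fact p.Prime] {K : Type} [Field K] [NumberField K]
  {R : Type} [CommRing R] [IsLocalRing R] [Algebra ℤ_[p] R]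
  {N : ℕ → Type} [∀ k, AddCommGroup (N k)] [∀ k, TopologicalSpace (N k)]
  [∀ k, DiscreteTopology (N k)] [∀ k, Module R (N k)]
  {Rk : ℕ → Type} [∀ k, CommRing (Rk k)] [∀ k, IsLocalRing (Rk k)] [∀ k, TopologicalSpace (Rk k)]
  [∀ k, DiscreteTopology (Rk k)] [∀ k, Algebra ℤ_[p] (Rk k)] [∀ k, Algebra R (Rk k)]
  [∀ k, Module (Rk k) (N k)] [∀ k, IsScalarTower R (Rk k) (N k)]
  {Nbar : Type} [AddCommGroup Nbar] [TopologicalSpace Nbar] [DiscreteTopology Nbar]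
  [∀ k, Module (Rk k) Nbar]
  {Nq : ℕ → Finset (HeightOneSpectrum (𝓞 K)) → Type} [∀ k n, AddCommGroup (Nq k n)]
  [∀ k n, TopologicalSpace (Nq k n)] [∀ k n, DiscreteTopology (Nq k n)]
  [∀ k n, Module (Rk k) (Nq k n)] [∀ k n, Module R (Nq k n)]
  [∀ k n, IsScalarTower R (Rk k) (Nq k n)]
  {R' : Type} [CommRing R'] [IsLocalRing R'] [Algebra ℤ_[p] R']
  {N' : ℕ → Type} [∀ k, AddCommGroup (N' k)] [∀ k, TopologicalSpace (N' k)]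
  [∀ k, DiscreteTopology (N' k)] [∀ k, Module R' (N' k)]
  {Rk' : ℕ → Type} [∀ k, CommRing (Rk' k)] [∀ k, IsLocalRing (Rk' k)] [∀ k, TopologicalSpace (Rk' k)]
  [∀ k, DiscreteTopology (Rk' k)] [∀ k, Algebra ℤ_[p] (Rk' k)] [∀ k, Algebra R' (Rk' k)]
  [∀ k, Module (Rk' k) (N' k)] [∀ k, IsScalarTower R' (Rk' k) (N' k)]
  {Nbar' : Type} [AddCommGroup Nbar'] [TopologicalSpace Nbar'] [DiscreteTopology Nbar']
  [∀ k, Module (Rk' k) Nbar']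
  {Nq' : ℕ → Finset (HeightOneSpectrum (𝓞 K)) → Type} [∀ k n, AddCommGroup (Nq' k n)]
  [∀ k n, TopologicalSpace (Nq' k n)] [∀ k n, DiscreteTopology (Nq' k n)]
  [∀ k n, Module (Rk' k) (Nq' k n)] [∀ k n, Module R' (Nq' k n)]
  [∀ k n, IsScalarTower R' (Rk' k) (Nq' k n)]
  {φ : R →+* R'} {S : CoeffTowerSetting p K R N Rk Nbar Nq}
  {S' : CoeffTowerSetting p K R' N' Rk' Nbar' Nq'}

/-- `H¹_s(K_v, fq_{k,n})` on the singular quotients. [cite: Howard2004HeegnerKolyvagin, Rem. 1.2.4 (arXiv p. 7, L13–27)] -/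
def fqSing (h : Hom φ S S') (k : ℕ) (n : Finset (HeightOneSpectrum (𝓞 K))) (v : HeightOneSpectrum (𝓞 K)) :
    SingularQuotient (GaloisRep.toLocal v ((S.LD k).ρq n)) →+
      SingularQuotient (GaloisRep.toLocal v ((S'.LD k).ρq n)) :=
  singularQuotientMap ((S.LD k).ρq n) ((S'.LD k).ρq n) v (h.fq k n) (fun _ y => h.fq_equivariant k n _ y)

/-- `H¹(fq_{k,n})` carries `H¹_{F(n)}(K, T^{(k)}/I_n)` into `H¹_{F′(n)}(K, T′^{(k)}/I′_n)` (same `jbar`).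
[cite: Howard2004HeegnerKolyvagin, Rem. 1.2.4 (ii)+(iii) (arXiv p. 7, L13–27)] -/
theorem fqH1_mem_selmerAt (h : Hom φ S S') (k : ℕ) {n : Finset (HeightOneSpectrum (𝓞 K))}
    {c : galoisCohomology ((S.LD k).ρq n) 1} (hc : c ∈ (S.LD k).selmerAt S.jbar n) :
    h.fqH1 k n c ∈ (S'.LD k).selmerAt S'.jbar n := by
  rw [h.jbar_eq]
  exact LevelData.cohomologyMap_mem_selmerAt (S.LD k) (S'.LD k) (h.f k) (h.f_equivariant k) (h.fq k)
    (h.fq_equivariant k) (h.fq_comp k) S.jbar (h.cond_le k) hc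

variable (h : Hom φ S S') (hL : ∀ k, (S.t k).primes = S.L) (hL' : ∀ k, (S'.t k).primes = S'.L)

include h hL hL' in
/-- Level-wise `𝓛′ ⊆ 𝓛` from `Hom.primes_subset` when the level triples carry the settings' prime
sets (for DVR settings: `DVRSetting.primes_eq`). [cite: Howard2004HeegnerKolyvagin, Rem. 1.2.4 (i) (arXiv p. 7, L14–15)] -/
theorem primes_subset_level (k : ℕ) : (S'.t k).primes ⊆ (S.t k).primes := by
  rw [hL k, hL' k]
  exact h.primes_subset

/-- **The pushed-forward level-`k` family** `κ′^{(k)}_n := (H¹(fq_{k,n}) ⊗ 1) κ^{(k)}_n` on `𝓝(𝓛′)`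
(zero off it). [cite: Howard2004HeegnerKolyvagin, Rem. 1.2.4 (arXiv Rem. 2.2.4, p. 7, L13–27)] -/
def pushforwardLevel (k : ℕ)
    (κ : ∀ n : Finset (HeightOneSpectrum (𝓞 K)), ↥((S.LD k).selmerAt S.jbar n) ⊗[ℤ] Gn (K := K) n) :
    ∀ n : Finset (HeightOneSpectrum (𝓞 K)), ↥((S'.LD k).selmerAt S'.jbar n) ⊗[ℤ] Gn (K := K) n :=
  LevelData.mapFamily (S.LD k) (S'.LD k) S.jbar S'.jbar (fun n => h.fqH1 k n)
    (fun _ _ hc => h.fqH1_mem_selmerAt k hc) κ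

/-- The level map `H¹(fq_{k,n}) ⊗ 1` on `H¹_{F(n)} ⊗ G_n` (abbreviation for the statements below).
[cite: Howard2004HeegnerKolyvagin, Rem. 1.2.4 (arXiv p. 7, L13–27)] -/
def levelMap (k : ℕ) (n : Finset (HeightOneSpectrum (𝓞 K))) :
    ↥((S.LD k).selmerAt S.jbar n) ⊗[ℤ] Gn (K := K) n →ₗ[ℤ]
      ↥((S'.LD k).selmerAt S'.jbar n) ⊗[ℤ] Gn (K := K) n :=
  LevelData.levelMap (S.LD k) (S'.LD k) S.jbar S'.jbar (fun n => h.fqH1 k n)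
    (fun _ _ hc => h.fqH1_mem_selmerAt k hc) n

include hL' in
/-- `κ′^{(k)}_n = (H¹(fq_{k,n}) ⊗ 1) κ^{(k)}_n` for `n ∈ 𝓝(𝓛′)`. [cite: Howard2004HeegnerKolyvagin, Rem. 1.2.4 (arXiv p. 7, L13–27)] -/
theorem pushforwardLevel_apply_of_mem (k : ℕ)
    (κ : ∀ n : Finset (HeightOneSpectrum (𝓞 K)), ↥((S.LD k).selmerAt S.jbar n) ⊗[ℤ] Gn (K := K) n)
    {n : Finset (HeightOneSpectrum (𝓞 K))} (hn : n ∈ levels S'.L) :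
    h.pushforwardLevel k κ n = h.levelMap k n (κ n) :=
  LevelData.mapFamily_apply_of_mem _ _ _ _ _ _ κ (by rwa [SelmerTriple.levelSet, hL' k])

include hL' in
/-- `κ′^{(k)}_n = 0` for `n ∉ 𝓝(𝓛′)`. [cite: Howard2004HeegnerKolyvagin, Def. 1.2.3 (arXiv p. 7, L10–12)] -/
theorem pushforwardLevel_apply_of_not_mem (k : ℕ)
    (κ : ∀ n : Finset (HeightOneSpectrum (𝓞 K)), ↥((S.LD k).selmerAt S.jbar n) ⊗[ℤ] Gn (K := K) n)
    {n : Finset (HeightOneSpectrum (𝓞 K))} (hn : n ∉ levels S'.L) :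
    h.pushforwardLevel k κ n = 0 :=
  LevelData.mapFamily_apply_of_not_mem _ _ _ _ _ _ κ (by rwa [SelmerTriple.levelSet, hL' k])

include hL hL' in
/-- **`κ^{(k)} ∈ KS(T^{(k)}, F, 𝓛) ⇒ κ′^{(k)} ∈ KS(T′^{(k)}, F′, 𝓛′)`** — all hypotheses of the
level-wise core discharged from the morphism: `hsel` (`fqH1_mem_selmerAt`), `hred`
(`LevelData.cohomologyMap_redH1`), `hloc` (`localization_fqH1`), `hsing` (definitional), `hfs`
(`fs_compat`), `hur` (`LevelData.localization_redH1_mem_unramifiedSubgroup`), `hprimes`.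
[cite: Howard2004HeegnerKolyvagin, Rem. 1.2.4 (arXiv Rem. 2.2.4, p. 7, L13–27)] -/
theorem pushforwardLevel_mem_KS (k : ℕ)
    {κ : ∀ n : Finset (HeightOneSpectrum (𝓞 K)), ↥((S.LD k).selmerAt S.jbar n) ⊗[ℤ] Gn (K := K) n}
    (hκ : κ ∈ (S.LD k).KS S.jbar) : h.pushforwardLevel k κ ∈ (S'.LD k).KS S'.jbar :=
  LevelData.mapFamily_mem_KS (S.LD k) (S'.LD k) S.jbar S'.jbar (fun n => h.fqH1 k n)
    (fun _ _ hc => h.fqH1_mem_selmerAt k hc) (fun n v => h.fqH1Loc k n (Sum.inr v))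
    (fun n v => h.fqSing k n v)
    (fun n v c => LevelData.cohomologyMap_redH1 (S.LD k) (S'.LD k) (h.f k) (h.fq k)
      (h.fq_equivariant k) (h.fq_comp k) n v c)
    (fun n v c => h.localization_fqH1 k n (Sum.inr v) c)
    (fun n v c => singularQuotientMap_singularMap _ _ v (h.fq k n) (fun _ y => h.fq_equivariant k n _ y) c)
    (h.fs_compat k)
    (fun n v hv hn _ hc => LevelData.localization_redH1_mem_unramifiedSubgroup (S.LD k) S.jbar hv
      (h.primes_subset_level hL hL' k (hn (Finset.mem_coe.mpr (Finset.mem_insert_self v n)))) hc)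
    (h.primes_subset_level hL hL' k) hκ

/-- `subtype′ ∘ (level map) = H¹(fq) ∘ subtype` on `H¹_{F(n)} ⊗ G_n` (tensored with `1`).
[cite: Howard2004HeegnerKolyvagin, Rem. 1.2.4 (arXiv p. 7, L13–27)] -/
theorem subtype_comp_levelMap (k : ℕ) (n : Finset (HeightOneSpectrum (𝓞 K))) :
    TensorProduct.map ((S'.LD k).selmerAt S'.jbar n).subtype.toIntLinearMap LinearMap.id ∘ₗ
        h.levelMap k n =
      TensorProduct.map (h.fqH1 k n).toIntLinearMap LinearMap.id ∘ₗ
        TensorProduct.map ((S.LD k).selmerAt S.jbar n).subtype.toIntLinearMap LinearMap.id := by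
  simp only [levelMap, LevelData.levelMap, ← TensorProduct.map_comp, LinearMap.comp_id]
  rfl

/-- `(rq′ ∘ subtype′) ∘ (level map at k+1) = H¹(fq_k) ∘ (rq ∘ subtype)` on `H¹_{F(n)} ⊗ G_n`
(tensored with `1`): the reductions in `k` commute with the change (`fqH1_rqH1`).
[cite: Howard2004HeegnerKolyvagin, Def. 1.2.3 / §1.6 (arXiv p. 7 L1–12, p. 11 L49–50)] -/
theorem rq_comp_levelMap (k : ℕ) (n : Finset (HeightOneSpectrum (𝓞 K))) :
    TensorProduct.map ((S'.rqH1 k n).comp ((S'.LD (k + 1)).selmerAt S'.jbar n).subtype).toIntLinearMap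
          LinearMap.id ∘ₗ h.levelMap (k + 1) n =
      TensorProduct.map (h.fqH1 k n).toIntLinearMap LinearMap.id ∘ₗ
        TensorProduct.map ((S.rqH1 k n).comp ((S.LD (k + 1)).selmerAt S.jbar n).subtype).toIntLinearMap
          LinearMap.id := by
  simp only [levelMap, LevelData.levelMap, ← TensorProduct.map_comp, LinearMap.comp_id]
  congr 1
  refine LinearMap.ext fun c => ?_
  simp only [LinearMap.coe_comp, Function.comp_apply, AddMonoidHom.coe_toIntLinearMap,
    AddMonoidHom.coe_comp, AddSubgroup.coe_subtype, LevelData.coe_selmerAtMap]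
  exact (h.fqH1_rqH1 k n c).symm

include hL hL' in
/-- **The pushforward `KS(T, F, 𝓛) → KS(T′, F′, 𝓛′)` of a Kolyvagin system along a morphism of tower
settings** (Rem. 1.2.4; the map of the proof of Thm. 2.2.10): level classes `(H¹(fq) ⊗ 1) κ`, bottom
class `H¹(f) κ_1`.
[cite: Howard2004HeegnerKolyvagin, Rem. 1.2.4 and proof of Thm. 2.2.10 (arXiv p. 7 L13–27, p. 17 L78–81)] -/
def pushforward (κ : S.KolyvaginSystem) : S'.KolyvaginSystem where
  κ k := h.pushforwardLevel k (κ.κ k)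
  ks k := h.pushforwardLevel_mem_KS hL hL' k (κ.ks k)
  κ_red k n := by
    by_cases hn : n ∈ levels S'.L
    · have e1 := LinearMap.congr_fun (h.rq_comp_levelMap k n) (κ.κ (k + 1) n)
      have e2 := LinearMap.congr_fun (h.subtype_comp_levelMap k n) (κ.κ k n)
      simp only [LinearMap.comp_apply] at e1 e2
      rw [h.pushforwardLevel_apply_of_mem hL' _ _ hn, h.pushforwardLevel_apply_of_mem hL' _ _ hn,
        e1, e2, κ.κ_red k n]
    · rw [h.pushforwardLevel_apply_of_not_mem hL' _ _ hn, h.pushforwardLevel_apply_of_not_mem hL' _ _ hn,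
        map_zero, map_zero]
  one k := h.fH1 k (κ.one k)
  one_mem := by
    have hmem := (AdicTower.mem_limitSelmer_iff _ _ _).mp κ.one_mem
    refine (AdicTower.mem_limitSelmer_iff _ _ _).mpr ⟨fun k => ?_, fun k => ?_⟩
    · exact h.mapsTo_limitH1 (x := κ.one) hmem.1 k
    · refine (SelmerStructure.mem_selmerGroup_iff _ _).mpr fun v => ?_
      rw [h.localization_fH1]
      exact h.cond_le k v ⟨_, (SelmerStructure.mem_selmerGroup_iff _ _).mp (hmem.2 k) v, rfl⟩
  κ_one k := by
    have e2 := LinearMap.congr_fun (h.subtype_comp_levelMap k ∅) (κ.κ k ∅)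
    simp only [LinearMap.comp_apply] at e2
    rw [h.pushforwardLevel_apply_of_mem hL' _ _ (empty_mem_levels _), e2, κ.κ_one k,
      TensorProduct.map_tmul, LinearMap.id_apply, AddMonoidHom.coe_toIntLinearMap, h.fqH1_cohomologyMap]

include hL hL' in
/-- The bottom class of the pushforward is `H¹(f_k) κ_1` at every level.
[cite: Howard2004HeegnerKolyvagin, Rem. 1.2.4 and proof of Thm. 2.2.10 (arXiv p. 7 L13–27, p. 17 L78–81)] -/
@[simp] theorem pushforward_one (κ : S.KolyvaginSystem) (k : ℕ) :
    (h.pushforward hL hL' κ).one k = h.fH1 k (κ.one k) :=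
  rfl

include hL hL' in
/-- The level classes of the pushforward on `𝓝(𝓛′)`. [cite: Howard2004HeegnerKolyvagin, Rem. 1.2.4 (arXiv p. 7, L13–27)] -/
theorem pushforward_κ_apply_of_mem (κ : S.KolyvaginSystem) (k : ℕ) {n : Finset (HeightOneSpectrum (𝓞 K))}
    (hn : n ∈ levels S'.L) : (h.pushforward hL hL' κ).κ k n = h.levelMap k n (κ.κ k n) :=
  h.pushforwardLevel_apply_of_mem hL' k _ hn

end CoeffTowerSetting.Hom

/-! ## DVR targets (the specialisation `T_𝔭` of Thm. 2.2.10) -/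

namespace DVRSetting

variable {p : ℕ} [Fact p.Prime] {K : Type} [Field K] [NumberField K]
  {R : Type} [CommRing R] [IsLocalRing R] [Algebra ℤ_[p] R]
  {N : ℕ → Type} [∀ k, AddCommGroup (N k)] [∀ k, TopologicalSpace (N k)]
  [∀ k, DiscreteTopology (N k)] [∀ k, Module R (N k)]
  {Rk : ℕ → Type} [∀ k, CommRing (Rk k)] [∀ k, IsLocalRing (Rk k)] [∀ k, TopologicalSpace (Rk k)]
  [∀ k, DiscreteTopology (Rk k)] [∀ k, Algebra ℤ_[p] (Rk k)] [∀ k, Algebra R (Rk k)]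
  [∀ k, Module (Rk k) (N k)] [∀ k, IsScalarTower R (Rk k) (N k)]
  {Nbar : Type} [AddCommGroup Nbar] [TopologicalSpace Nbar] [DiscreteTopology Nbar]
  [∀ k, Module (Rk k) Nbar]
  {Nq : ℕ → Finset (HeightOneSpectrum (𝓞 K)) → Type} [∀ k n, AddCommGroup (Nq k n)]
  [∀ k n, TopologicalSpace (Nq k n)] [∀ k n, DiscreteTopology (Nq k n)]
  [∀ k n, Module (Rk k) (Nq k n)] [∀ k n, Module R (Nq k n)]
  [∀ k n, IsScalarTower R (Rk k) (Nq k n)]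
  {R' : Type} [CommRing R'] [IsDomain R'] [IsDiscreteValuationRing R'] [Algebra ℤ_[p] R']
  {N' : ℕ → Type} [∀ k, AddCommGroup (N' k)] [∀ k, TopologicalSpace (N' k)]
  [∀ k, DiscreteTopology (N' k)] [∀ k, Module R' (N' k)]
  {Rk' : ℕ → Type} [∀ k, CommRing (Rk' k)] [∀ k, IsLocalRing (Rk' k)] [∀ k, TopologicalSpace (Rk' k)]
  [∀ k, DiscreteTopology (Rk' k)] [∀ k, Algebra ℤ_[p] (Rk' k)] [∀ k, Algebra R' (Rk' k)]
  [∀ k, Module (Rk' k) (N' k)] [∀ k, IsScalarTower R' (Rk' k) (N' k)]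
  {Nbar' : Type} [AddCommGroup Nbar'] [TopologicalSpace Nbar'] [DiscreteTopology Nbar']
  [∀ k, Module (Rk' k) Nbar']
  {Nq' : ℕ → Finset (HeightOneSpectrum (𝓞 K)) → Type} [∀ k n, AddCommGroup (Nq' k n)]
  [∀ k n, TopologicalSpace (Nq' k n)] [∀ k n, DiscreteTopology (Nq' k n)]
  [∀ k n, Module (Rk' k) (Nq' k n)] [∀ k n, Module R' (Nq' k n)]
  [∀ k n, IsScalarTower R' (Rk' k) (Nq' k n)]
  {φ : R →+* R'} {S : CoeffTowerSetting p K R N Rk Nbar Nq} {S₂ : DVRSetting p K R' N' Rk' Nbar' Nq'}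

/-- **Specialisation of a Kolyvagin system to a DVR setting** (Thm. 2.2.10, proof, first map:
`KS(𝐓, F_Λ, 𝓛) → KS(T_𝔭, F_𝔭, 𝓛′)`): the pushforward along a morphism from a general tower
setting whose level triples carry its prime set (the target's do by `SatisfiesH.primes_eq`).
[cite: Howard2004HeegnerKolyvagin, proof of Thm. 2.2.10 (arXiv Thm. 3.2.10, p. 17, L78–81)] -/
def KolyvaginSystem.ofHom (h : CoeffTowerSetting.Hom φ S S₂.toCoeffTowerSetting)
    (hL : ∀ k, (S.t k).primes = S.L) (hy : S₂.SatisfiesH) (κ : S.KolyvaginSystem) : S₂.KolyvaginSystem :=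
  KolyvaginSystem.ofCoeff (h.pushforward hL hy.primes_eq κ)

/-- Its bottom class is `H¹(f_k) κ_1`. [cite: Howard2004HeegnerKolyvagin, proof of Thm. 2.2.10 (arXiv p. 17, L78–81)] -/
@[simp] theorem KolyvaginSystem.ofHom_one (h : CoeffTowerSetting.Hom φ S S₂.toCoeffTowerSetting)
    (hL : ∀ k, (S.t k).primes = S.L) (hy : S₂.SatisfiesH) (κ : S.KolyvaginSystem) (k : ℕ) :
    (KolyvaginSystem.ofHom h hL hy κ).one k = h.fH1 k (κ.one k) :=
  rfl

end DVRSetting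



end Literature.NumberTheory.GaloisCohomology.Howard2004

end
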